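import Summits.ABC.ABC.Theses.IneffectiveSubspace

/-!
# `UniformSadicGivesTowerFour` (stmt-ABC-15070, route ABC/IneffectiveSubspace)

This file proves the support item `UniformSadicGivesTowerFour` of the route file
`Summits/ABC/ABC/Theses/IneffectiveSubspace.lean`:

`UniformSadicTowerFour → TowerFourSubLiouville`.

**Proof.**  Specialise `UniformSadicTowerFour` to `K = 0`, `S = ∅`: the bracket
`(∏_{p ∈ ∅} p) · ∏_{p ∈ M.primeFactors \ ∅} p ^ v_p(M)` with `M = ∏ xᵢ yᵢ zᵢ` is `M` itself
(`M ≠ 0` by positivity, `Nat.prod_factorization_pow_eq_self`), so `K = 0` of the crux is the level-4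
tower inequality with exponent `1`, i.e. `TowerFourSubLiouville` with `A := 1 < 2` and the same
constant `C(0, ε)`.

Sources: P. Vojta, *On the ABC conjecture and diophantine approximation by rational points*,
Amer. J. Math. 122 (2000), §3 [Vojta2000ABC] (the level-4 pair); D. Ridout, *The p-adic
generalization of the Thue–Siegel–Roth theorem*, Mathematika 5 (1958) [Ridout1958] (context only).
Uses only Mathlib (`Nat.factorization`, `Nat.primeFactors`).
-/

-- `Summit.<Summit>.<Problem>` is the mandated summit-side namespace (CONVENTIONS §2); for the
-- single-conjunct summit `ABC` the two coincide, so the duplicate `ABC.ABC` is deliberate.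
set_option linter.dupNamespace false

namespace Summit.ABC.ABC.Theorems

open scoped BigOperators
open Finset

/-- The `S = ∅` bracket of `UniformSadicTowerFour` is the number itself: for `M ≠ 0`,
`(∏_{p ∈ ∅} p) · ∏_{p ∈ M.primeFactors \ ∅} p ^ v_p(M) = M`. [folklore: unique factorisation] -/
theorem UniformSadicGivesTowerFour.bracket_empty {M : ℕ} (hM : M ≠ 0) :
    (∏ p ∈ (∅ : Finset ℕ), p) * ∏ p ∈ M.primeFactors \ ∅, p ^ M.factorization p = M := by
  rw [Finset.prod_empty, one_mul, Finset.sdiff_empty]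
  conv_rhs => rw [← Nat.prod_factorization_pow_eq_self hM,
    Nat.prod_factorization_eq_prod_primeFactors]

/-- **stmt-ABC-15070** (`UniformSadicGivesTowerFour`): crux #2 `UniformSadicTowerFour` at
`K = 0`, `S = ∅` is the level-4 tower inequality with exponent `1`, hence crux #4
`TowerFourSubLiouville` holds with `A := 1 < 2` and the same constant `C(0, ε)`. -/
theorem uniformSadicGivesTowerFour_proof :
    Summit.ABC.ABC.Theses.IneffectiveSubspace.UniformSadicGivesTowerFour := by
  unfold Summit.ABC.ABC.Theses.IneffectiveSubspace.UniformSadicGivesTowerFour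
    Summit.ABC.ABC.Theses.IneffectiveSubspace.UniformSadicTowerFour
    Summit.ABC.ABC.Theses.IneffectiveSubspace.TowerFourSubLiouville
  intro hT
  refine ⟨1, by norm_num, fun ε hε => ?_⟩
  obtain ⟨C, hC, hTow⟩ := hT 0 ε hε
  refine ⟨C, hC, fun x y z hpos hsum hcop => ?_⟩
  have hM : (∏ i, x i * y i * z i) ≠ 0 :=
    (Finset.prod_pos fun i _ =>
      Nat.mul_pos (Nat.mul_pos (hpos i).1 (hpos i).2.1) (hpos i).2.2).ne'
  have h := hTow ∅ (by simp) (by simp) x y z hpos hsum hcop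
  rwa [UniformSadicGivesTowerFour.bracket_empty hM] at h

end Summit.ABC.ABC.Theorems
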